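import Literature.IUT.LogVolume.GenuineLogThetaPoint
import Literature.IUT.LogVolume.Corollary22Legendre
import HarnessLib

/-!
# `d_mod` of a genuine Θ-volume datum at a point of the `λ`-line

Mochizuki, *Inter-universal Teichmüller theory IV*, RIMS manuscript (Apr. 2020), Thm. 1.10 (p. 22): "`d_mod := [F_mod : ℚ]`"
with `F_mod` the field of moduli; [IUTchIV] Cor. 2.2 (ii), p. 42: "`F_mod` for the minimal field of definition of the
corresponding point `∈ M_ell(ℚ̄)`".

Proof-only companion of `GenuineLogThetaPoint.lean`: the READING-INDEPENDENT degree fact a datum `T :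
Cor22.ThetaVolumeDatumAt P l` carries through `j_eq : j(E_F) = j(λ)` alone — `[ℚ(j(E_F)) : ℚ] = [ℚ(j(λ)) : ℚ] = d_mod`
(abc-iut-L5-t2's `fieldOfModuli E_F ⊆ F` vs abc-iut-S-d2's `Cor22.dmod P`). (v2 of this file: the v1 lemmas about
`[F : F_tpd]` / `[F : F_mod]` were stated through the `F_W`-model pinning `isModelField` of the datum's v2, a reading the
cell WITHDREW 2026-08-26T02:33Z (abc-iut-plan, F-c312-8-g3-1); they are removed here before the datum drops that field,
and return — derived from the v3 pinning `Cor22.IsSubThetaField` — with the Step (ii) tower arithmetic.) Classical;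
TAKES NO SIDE on anything disputed. [cite: Mochizuki2012, IUTchIV Thm. 1.10 p. 22] (claim key, disputed).
-/

noncomputable section

namespace Literature.IUT.LogVolume

namespace Cor22

namespace ThetaVolumeDatumAt

open Literature.IUT.HodgeTheaters NumberField
open Literature.NumberTheory.DiophantineGeometry.GenEll
open scoped Classical

variable {P : NFPoint} {l : ℕ} (T : ThetaVolumeDatumAt P l)

/-- **`[ℚ(j(E_F)) : ℚ] = [ℚ(j(λ)) : ℚ]`**: `j(E_F)` is the image of `j(λ)` in `F` (`j_eq`), so the two simple extensions
have the same minimal polynomial over `ℚ`. Here `ℚ(j(E_F))` is abc-iut-L5-t2's `fieldOfModuli E_F ⊆ F` and `ℚ(j(λ)) ⊆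
F_tpd`. [cite: Mochizuki2012, IUTchIV Thm. 1.10 p. 22] -/
theorem finrank_rat_fieldOfModuli_eq :
    (letI := T.instFieldF; letI := T.instNumberFieldF; letI := T.instIsElliptic; Module.finrank ℚ (fieldOfModuli T.E)) =
      Module.finrank ℚ (IntermediateField.adjoin ℚ ({jInv P.x} : Set P.F)) := by
  letI := T.instFieldF; letI := T.instNumberFieldF; letI := T.instAlgebraF; letI := T.instIsElliptic
  have hj : IsIntegral ℚ T.E.j := Algebra.IsIntegral.isIntegral T.E.j
  have hx : IsIntegral ℚ (jInv P.x) := Algebra.IsIntegral.isIntegral (jInv P.x)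
  unfold fieldOfModuli
  rw [IntermediateField.adjoin.finrank hj, IntermediateField.adjoin.finrank hx, T.j_eq,
    minpoly.algebraMap_eq (algebraMap P.F T.F).injective]

/-- **`[F_mod : ℚ] = d_mod` at the datum**: `[ℚ(j(E_F)) : ℚ] = Cor22.dmod P` (abc-iut-S-d2's `d_mod := [ℚ(j(λ)) : ℚ]`,
[IUTchIV] Thm. 1.10 p. 22 "`d_mod := [F_mod : ℚ]`"). [cite: Mochizuki2012, IUTchIV Thm. 1.10 p. 22] -/
theorem finrank_rat_fieldOfModuli_eq_dmod :
    (letI := T.instFieldF; letI := T.instNumberFieldF; letI := T.instIsElliptic; Module.finrank ℚ (fieldOfModuli T.E)) =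
      dmod P :=
  T.finrank_rat_fieldOfModuli_eq

/-- `[F : ℚ] = d_mod · [F : F_mod]` at the datum (tower law for `ℚ ⊆ F_mod = ℚ(j(E_F)) ⊆ F`).
[cite: Mochizuki2012, IUTchIV Thm. 1.10 p. 22] -/
theorem finrank_rat_eq_dmod_mul :
    (letI := T.instFieldF; letI := T.instNumberFieldF; Module.finrank ℚ T.F) =
      dmod P * (letI := T.instFieldF; letI := T.instNumberFieldF; letI := T.instIsElliptic;
        Module.finrank (fieldOfModuli T.E) T.F) := by
  letI := T.instFieldF; letI := T.instNumberFieldF; letI := T.instAlgebraF; letI := T.instIsElliptic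
  rw [← T.finrank_rat_fieldOfModuli_eq_dmod]
  exact (Module.finrank_mul_finrank ℚ (fieldOfModuli T.E) T.F).symm

end ThetaVolumeDatumAt

end Cor22

end Literature.IUT.LogVolume

end
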